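import HarnessLib.Audit.LibrarySuggestionsDenyListCorCM
import Summits.HodgeConjecture.CorCM.HypLiu418.A3Liu418GSConjugateTransport
import Literature.NumberTheory.Automorphic.Liu2021.AppendixC.OmegaHomTowerTransport
import HarnessLib

/-!
# The multiplicity space `Hom_{U(J⋆)(𝔸_f)}(ι′ ∘ ρ, ℚ̄_ℓ ⊗ H¹_ét)` has the SAME rank on the twisted record tower `X⋆` and on the untwisted `M⋆`

Cell `hodgecm-mathlib` (D-0151), fan A; Summits lane `CorCM/HypLiu418/`; namespace `Summit.HodgeConjecture.CorCM.Lines.A3Liu418`.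
Seat A-p15 (g12), 2026-08-30.  ONE THEOREM (no definition, no named fact, no `sorry`): for every `ℂ[U(J⋆)(𝔸_{F⁺,f})]`-module `(W, ρ)`,

  `rank_omegaHom_GS_eq_GSM : Module.rank ℚ̄_ℓ ((etaleHeckeDatumGS S …).omegaHom ι′ ρ) = Module.rank ℚ̄_ℓ ((etaleHeckeDatumGSM S …).omegaHom ι′ ρ)`

— the K2 transport ★ `k2_towerEquiv` (`A3Liu418GSConjugateTransport`: a `ℚ_ℓ`-linear isomorphism `Ψ : H¹_ét(X⋆-tower) ≃ H¹_ét(M⋆-tower)`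
intertwining the translate-induced Hecke actions) fed to the generic ★ `Sec42Data.EtaleHeckeDatum.rank_omegaHom_eq_of_towerEquiv`
(`Liu2021/AppendixC/OmegaHomTowerTransport`).  Consumer: the d6 line of crux `HLiu418` (stmt-HodgeConjecture-24832) — any text about the
RANK of the multiplicity space of an oscillator label (e.g. [Liu2021, Prop. D.4 (1)] «dimension 1») may be stated on either tower.
`Exists.elim`, not `obtain`, on the K2 package (the ∃ is too large for `rcases` at the default budget).
HC_CM is proved only modulo the 7 printed citations until rung 0 closes; nothing of [Liu2021] is asserted here.

References: [Liu2021] §4.2–§4.3 (FJcycle.tex l. 2074, 2158–2165); [Deligne1982] §1 (conjugation of abelian varieties).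
-/

set_option autoImplicit false

noncomputable section

open scoped TensorProduct NumberField
open NumberField
open Literature.AlgebraicGeometry.ShimuraVarieties.UnitaryCanonicalModel
open Literature.NumberTheory.Automorphic Literature.NumberTheory.Automorphic.UnitaryGroup
open Literature.NumberTheory.Automorphic.Liu2021 Literature.NumberTheory.Automorphic.Liu2021.AppendixC

namespace Summit.HodgeConjecture.CorCM.Lines.A3Liu418

variable {F : CMField} {ι₁ : F →+* ℂ} {Jstar : Matrix (Fin 2) (Fin 2) F}
  {K₀ : C5.OpenCompactSubgroup ↥(finAdelic (↥(maximalRealSubfield F)) F (IsCMField.complexConj F) 2 Jstar)}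
  (S : RecordSystemGS F Jstar ι₁ K₀) (h4 : 4 ≤ Module.finrank ℚ F) (iso : ℕ → Prop)
  (hU7ₛ : S.HeckeTranslateDefinedOver) (hLQ : S.IsLevelQuotient) (ℓ : ℕ) [Fact ℓ.Prime]
  (ι' : ℂ ≃+* AlgebraicClosure ℚ_[ℓ])

/-- **The multiplicity space has the same `ℚ̄_ℓ`-rank on the twisted tower `X⋆` (`etaleHeckeDatumGS`) and on the untwisted `M⋆`
(`etaleHeckeDatumGSM`)**, for every `ℂ[U(J⋆)(𝔸_f)]`-module `(W, ρ)` — ★ `k2_towerEquiv` (K2a)+(K2b honest) fed to the generic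
★ `rank_omegaHom_eq_of_towerEquiv` / `towerEquiv_symm_rhoEt`. [cite: Liu2021, §4.2–§4.3 (FJcycle.tex l. 2074, 2158–2165)] [cite: Deligne1982, §1] -/
theorem rank_omegaHom_GS_eq_GSM {W : Type} [AddCommGroup W] [Module ℂ W]
    (ρ : Representation ℂ ↥(finAdelic (↥(maximalRealSubfield F)) F (IsCMField.complexConj F) 2 Jstar) W) :
    Module.rank (AlgebraicClosure ℚ_[ℓ]) ↥((etaleHeckeDatumGS S hU7ₛ hLQ h4 iso ℓ).omegaHom ι' ρ) =
      Module.rank (AlgebraicClosure ℚ_[ℓ]) ↥((etaleHeckeDatumGSM S hU7ₛ hLQ h4 iso ℓ).omegaHom ι' ρ) :=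
  (k2_towerEquiv (S := S) h4 iso hU7ₛ hLQ ℓ).elim fun Ψ hΨ =>
    Sec42Data.EtaleHeckeDatum.rank_omegaHom_eq_of_towerEquiv (etaleHeckeDatumGS S hU7ₛ hLQ h4 iso ℓ)
      (etaleHeckeDatumGSM S hU7ₛ hLQ h4 iso ℓ) ι' ρ ρ id (fun _ => rfl) id (fun _ => rfl) Ψ hΨ.1
      (Sec42Data.EtaleHeckeDatum.towerEquiv_symm_rhoEt (etaleHeckeDatumGS S hU7ₛ hLQ h4 iso ℓ)
        (etaleHeckeDatumGSM S hU7ₛ hLQ h4 iso ℓ) id Ψ hΨ.1)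

end Summit.HodgeConjecture.CorCM.Lines.A3Liu418

end
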